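import Mathlib

/-!
# Stub `stub_caseII_monomialDvd` (line `eac-extends-core-automorphisms`, crux stmt-Schanuel-0968)

**A factor of a non-zero monomial is a non-zero constant times a monomial.**

In the polynomial ring `k[X₁, …, X_p]` over a field `k`, if `f * g = monomial d c` with `c ≠ 0`,
then `f = monomial d' c'` for some exponent `d'` and some `c' ≠ 0`.  This is the
denominator-cleared form of the statement that the units of the Laurent polynomial ring
`k[X₁^{±1}, …, X_p^{±1}]` are exactly the non-zero scalar multiples of monomials, used in
`stub_caseII_core` to see that two Laurent polynomials whose product is a Laurent monomial are
themselves Laurent monomials.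

The proof is immediate from Mathlib's `MvPolynomial.dvd_monomial_iff_exists` (divisors of
`monomial n a`, `a ≠ 0`, over a commutative ring without zero divisors are the `monomial m b`
with `m ≤ n` and `b ∣ a`); `b ≠ 0` because `b ∣ c` and `c ≠ 0`.
-/

-- `Summit.Schanuel.Schanuel.…` is the single-problem-summit namespace by design (D-0017).
set_option linter.dupNamespace false

namespace Summit.Schanuel.Schanuel.Theorems.RigidCore

/-- **A factor of a non-zero monomial is a non-zero constant times a monomial.**
If `f * g = monomial d c` in `MvPolynomial (Fin p) k` over a field `k` with `c ≠ 0`, then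
`f = monomial d' c'` for some `d' : Fin p →₀ ℕ` and some `c' ≠ 0`. -/
theorem stub_caseII_monomialDvd {k : Type} [Field k] {p : ℕ} {f g : MvPolynomial (Fin p) k}
    {d : Fin p →₀ ℕ} {c : k} (hc : c ≠ 0) (h : f * g = MvPolynomial.monomial d c) :
    ∃ (d' : Fin p →₀ ℕ) (c' : k), c' ≠ 0 ∧ f = MvPolynomial.monomial d' c' := by
  have hdvd : f ∣ MvPolynomial.monomial d c := ⟨g, h.symm⟩
  obtain ⟨m, b, -, hb, rfl⟩ := (MvPolynomial.dvd_monomial_iff_exists hc).mp hdvd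
  refine ⟨m, b, ?_, rfl⟩
  rintro rfl
  exact hc (zero_dvd_iff.mp hb)

end Summit.Schanuel.Schanuel.Theorems.RigidCore
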